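import Mathlib
import Summits.KontsevichZagierPeriods.Zeta5Search.Profile6aCellsA
import Summits.KontsevichZagierPeriods.Zeta5Search.Profile6aCellsB
import Summits.KontsevichZagierPeriods.Zeta5Search.DenomLaw.Profile15aPath
import Summits.KontsevichZagierPeriods.Zeta5Search.DenomLaw.PathWeightProfile
import Summits.KontsevichZagierPeriods.Zeta5Search.DenomLaw.DoubleDropAnyDepthKit
import Summits.KontsevichZagierPeriods.Zeta5Search.DenomLaw.LawA3KCoverKit
import HarnessLib

/-!
# ζ(5) search — the `N_p = 6` PROFILE 6a of the first period for EVERY sorted parameter vector: PATH accounting at every depth (DENOM-LAW D1, prover-d1 gen 23)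

Cell `pub-zeta5` (HONEST FRAMING: systematic search; no irrationality claim unless certified), TRACK «DENOM-LAW» D1 prover seat (denom-prover-d1
gen 23, `HOME/denom-law/prover-d1/ATTEMPT-23.md`).  The `N_p = 6` profile 6a of the a = 7 stratum: short pair blocks all `(1,k)`, `(2,k)`, `(3,k)` — as ORDER conditions `b₀ < p + b₃ + b₇`,
`p + b₄ + b₅ ≤ b₀` with the sorted chain.  On it `d < 2p`, and the node `⌊d/p⌋ − N_p − min(0, 5 − C⋆)`
asks `−3` at `d < p` and `−2` at `p ≤ d` (`C⋆ ≤ 8`, `cStar_le_eight_6a` here: the long blocks are the pairs within `{4,5,6,7}`).  It is one of the two «B-profiles» left open by gen 22 (ATTEMPT-22 §4 (2)): at `d < p` a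
centre-free class `[1,−3,−3,1]` of exponent `−4` can be realised, where THEOREM LB gives only `−4` and the landed double drop (`doubleDrop_of_cover`)
carries `p ≤ d`.  The law used here at ANY depth is gen 22's DOUBLE DROP AT ANY DEPTH (`DenomLaw/DoubleDropAnyDepthKit`: the `Ω`-bracket of the
Casoratian split no longer vanishes but is `p`-integral times `‖V‖ ≤ p^{N−1}`, so `v_p(Cas_j) ≥ 5 − 2N` survives without `p ≤ d`) in its B-law form
`DenomLaw.cover_B0_j` at `N = 4` with THEOREM LB's `d < p` row as fallback (`checkLBx (−4; −3, 0)`): `−3`.  At `p ≤ d` THEOREM A‴ in 𝒦-form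
(`DenomLaw.cover_A3K`, gen 19) at `(4, [1,−3,−3,1])` gives `6 − 2M = −2`.  Both spelled-out checks are `decide`d on the WHOLE type lists of the
machine-generated covers `FullProfile.cover6a_ev/od` (`Profile6aCells{A,B}`, gen 17/18's generator with the new constraint set; every leaf lemma reused
from landed profiles), so the theorems hold for every `p` (p-uniform hypotheses: the node's binders, `p ≤ b₇`, and the pair-block ORDER conditions only).
Results: `pathAccounting_profile6a` (every `j`) and **`pathAccountingFirstPeriod_profile6a`** (the node's binders VERBATIM plus `p ≤ b₇` and the profile
inequalities; no depth hypothesis).  Census beside the proof (gen 22 classifier, exhaustive a = 7 at p = 7, 11): 6a: 4,560 instances, every one reached by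
exactly these two rungs; 0 open at p ≤ 13 (kit j285126).  MODEL/structure-side valuation bookkeeping of the cell's own rationals; nothing about ζ(5); no γ;
records in print UNMOVED.
-/

open Finset

namespace Summit.KontsevichZagierPeriods.Zeta5Search.FullProfile

open Summit.KontsevichZagierPeriods.Zeta5Search.ClusterValuation
open Summit.KontsevichZagierPeriods.Zeta5Search.CasoratianValuation (InPolytope shift casoratian pairFloors refund)
open Summit.KontsevichZagierPeriods.Zeta5Search.WedgeDictionary (dOf)
open Summit.KontsevichZagierPeriods.Zeta5Search.ClassTypeCover
open Summit.KontsevichZagierPeriods.Zeta5Search.DenomLaw (cStar FirstPeriod Sorted7 cover_A3K cover_B0_j)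
open Summit.KontsevichZagierPeriods.Zeta5Search.DenomLaw.FirstPeriodKit (sorted7_chain firstPeriod_pair pairFloors_expand)
open Summit.KontsevichZagierPeriods.Zeta5Search.SortedProfile

/-! ## The path-weight bound on 6a -/

/-- **`C⋆ ≤ 8` on 6a** (long blocks: the pairs within `{4,5,6,7}` only — a Hamiltonian path meets at most three of them): the finite check over the
5,040 orderings (`decide +kernel`). -/
theorem cStar_le_eight_6a {b : ℕ → ℤ} {p : ℕ} (hs : Sorted7 b) (hQ : b 0 < (p : ℤ) + b 3 + b 7) : cStar b p ≤ 8 := by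
  obtain ⟨h21, h32, h43, h54, h65, h76⟩ := sorted7_chain hs
  refine DenomLaw.FirstPeriodKit.cStar_le_of_profile (fun _ => True)
    (fun i k => ¬ ((i.val ≤ 2 ∨ k.val ≤ 2) ∧ i.val ≠ k.val)) 8
    (fun _ _ => trivial) ?_ (by decide +kernel)
  intro i k hik h
  obtain ⟨h, hne⟩ := h
  have := i.isLt; have := k.isLt
  exfalso
  rcases h with hi | hk <;> interval_cases hv : i.val <;> interval_cases hw : k.val <;> simp only [Nat.reduceAdd] at hik <;> omega

/-! ## The `N_p = 6` profile with short blocks all `(1,k)`, `(2,k)`, `(3,k)` -/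

section P6A

variable {b : ℕ → ℤ} {j p : ℕ}

/-- **`N_p = 6`** on this profile: the pair digits of the 15 short blocks are `0`, the other 6 are `1`. -/
theorem pairFloors_eq_6a (hb : InPolytope b) (hs : Sorted7 b) (hp : 0 < p) (hQ : b 0 < (p : ℤ) + b 3 + b 7) (hQ45 : (p : ℤ) + b 4 + b 5 ≤ b 0) (hfp : FirstPeriod b p) : pairFloors b p = 6 := by
  obtain ⟨h21, h32, h43, h54, h65, h76⟩ := sorted7_chain hs
  obtain ⟨h0, hb1, hb2, hb3, hb4, hb5, hb6, hb7, hc1⟩ := box hb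
  have hp0 : (0 : ℤ) < p := by exact_mod_cast hp
  have one : ∀ z : ℤ, (p : ℤ) ≤ z → z ≤ 2 * (p : ℤ) - 1 → z / (p : ℤ) = 1 := fun z h1 h2 => by
    rw [Int.ediv_eq_iff_of_pos hp0]; constructor <;> linarith
  have z12 : (b 0 - b 1 - b 2) / (p : ℤ) = 0 := Int.ediv_eq_zero_of_lt (by linarith) (by linarith)
  have z13 : (b 0 - b 1 - b 3) / (p : ℤ) = 0 := Int.ediv_eq_zero_of_lt (by linarith) (by linarith)
  have z14 : (b 0 - b 1 - b 4) / (p : ℤ) = 0 := Int.ediv_eq_zero_of_lt (by linarith) (by linarith)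
  have z15 : (b 0 - b 1 - b 5) / (p : ℤ) = 0 := Int.ediv_eq_zero_of_lt (by linarith) (by linarith)
  have z16 : (b 0 - b 1 - b 6) / (p : ℤ) = 0 := Int.ediv_eq_zero_of_lt (by linarith) (by linarith)
  have z17 : (b 0 - b 1 - b 7) / (p : ℤ) = 0 := Int.ediv_eq_zero_of_lt (by linarith) (by linarith)
  have z23 : (b 0 - b 2 - b 3) / (p : ℤ) = 0 := Int.ediv_eq_zero_of_lt (by linarith) (by linarith)
  have z24 : (b 0 - b 2 - b 4) / (p : ℤ) = 0 := Int.ediv_eq_zero_of_lt (by linarith) (by linarith)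
  have z25 : (b 0 - b 2 - b 5) / (p : ℤ) = 0 := Int.ediv_eq_zero_of_lt (by linarith) (by linarith)
  have z26 : (b 0 - b 2 - b 6) / (p : ℤ) = 0 := Int.ediv_eq_zero_of_lt (by linarith) (by linarith)
  have z27 : (b 0 - b 2 - b 7) / (p : ℤ) = 0 := Int.ediv_eq_zero_of_lt (by linarith) (by linarith)
  have z34 : (b 0 - b 3 - b 4) / (p : ℤ) = 0 := Int.ediv_eq_zero_of_lt (by linarith) (by linarith)
  have z35 : (b 0 - b 3 - b 5) / (p : ℤ) = 0 := Int.ediv_eq_zero_of_lt (by linarith) (by linarith)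
  have z36 : (b 0 - b 3 - b 6) / (p : ℤ) = 0 := Int.ediv_eq_zero_of_lt (by linarith) (by linarith)
  have z37 : (b 0 - b 3 - b 7) / (p : ℤ) = 0 := Int.ediv_eq_zero_of_lt (by linarith) (by linarith)
  have U := fun (i k : ℕ) (hi : i < 7) (hk : k < 7) (hik : i < k) => firstPeriod_pair hfp hi hk hik
  rw [pairFloors_expand, z12, z13, z14, z15, z16, z17, z23, z24, z25, z26, z27, z34, z35, z36, z37,
    one _ (by linarith) (U 3 4 (by norm_num) (by norm_num) (by norm_num)),
    one _ (by linarith) (U 3 5 (by norm_num) (by norm_num) (by norm_num)),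
    one _ (by linarith) (U 3 6 (by norm_num) (by norm_num) (by norm_num)),
    one _ (by linarith) (U 4 5 (by norm_num) (by norm_num) (by norm_num)),
    one _ (by linarith) (U 4 6 (by norm_num) (by norm_num) (by norm_num)),
    one _ (by linarith) (U 5 6 (by norm_num) (by norm_num) (by norm_num))]
  norm_num

/-- **The B-law AT ANY DEPTH on this profile, general `b`**: `v_p(Cas_j(b)) ≥ -3` — where a multipole class of type `[1,−3,−3,1]` (exponent `−4`)
is realised the double drop WITHOUT `p ≤ d` gives `5 − 2N = −3` at `N = 4` (gen 22's `DenomLaw.cover_B0_j`, the `Ω`-bracket bounded by `p^{N−1}`); where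
none is, THEOREM LB off the `−4`-types with the `d < p` row (`checkLBx (−4; −3, 0)`, `B′ ≤ 0`) gives `−3` as well.  No hypothesis on `d`. -/
theorem cas_ge6a_neg3 (hb : InPolytope b) (hs : Sorted7 b) (hbj : InPolytope (shift b j)) (hj1 : 1 ≤ j) (hj7 : j ≤ 7)
    (hprime : p.Prime) (hp5 : 5 ≤ p) (hwin : (b 0 + 2 : ℤ) < (p : ℤ) ^ 2) (hP : (p : ℤ) ≤ b 7) (hQ : b 0 < (p : ℤ) + b 3 + b 7) (hQ45 : (p : ℤ) + b 4 + b 5 ≤ b 0)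
    (hF1 : b 1 < 2 * (p : ℤ)) (hF2 : b 0 < 2 * (p : ℤ) + b 6 + b 7) (hcas : casoratian b j ≠ 0) : (-3 : ℤ) ≤ padicValRat p (casoratian b j) := by
  haveI : Fact p.Prime := ⟨hprime⟩
  have hp2 : p % 2 = 1 := Nat.odd_iff.1 (hprime.odd_of_ne_two (by omega))
  obtain ⟨h21, h32, h43, h54, h65, h76⟩ := sorted7_chain hs
  have hpb : (p : ℤ) ≤ b 0 := by linarith
  rcases Int.emod_two_eq_zero_or_one (b 0) with hr | hr
  · exact cover_B0_j hb hj1 hj7 hbj hprime hp5 hpb hwin (cover6a_ev hb hs hP hQ hQ45 hF1 hF2 hp5 hp2 hr) (N := 4) (by norm_num) (by decide) (A' := -3) (B' := 0) (c := -3)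
      (by rw [oddFlag_false hr]; decide) (by rw [oddFlag_false hr]; decide) (by norm_num) (by norm_num) (by norm_num) (by norm_num) hcas
  · exact cover_B0_j hb hj1 hj7 hbj hprime hp5 hpb hwin (cover6a_od hb hs hP hQ hQ45 hF1 hF2 hp5 hp2 hr) (N := 4) (by norm_num) (by decide) (A' := -3) (B' := 0) (c := -3)
      (by rw [oddFlag_true hr]; decide) (by rw [oddFlag_true hr]; decide) (by norm_num) (by norm_num) (by norm_num) (by norm_num) hcas

/-- **THEOREM A‴ (𝒦-form, `p ≤ d`) on this profile, general `b`**: `v_p(Cas_j(b)) ≥ −2 = 6 − 2M` in the frame `(4, [1,−3,−3,1])` (gen 19's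
`DenomLaw.cover_A3K`; its four clauses hold on both covers — every multipole class at exponent `−4` is the centre-free palindrome `[1,−3,−3,1]`, every
class with `ν = −3` is one of its unit raises). -/
theorem cas_ge6a_neg2 (hb : InPolytope b) (hs : Sorted7 b) (hbj : InPolytope (shift b j)) (hj1 : 1 ≤ j) (hj7 : j ≤ 7)
    (hprime : p.Prime) (hp5 : 5 ≤ p) (hwin : (b 0 + 2 : ℤ) < (p : ℤ) ^ 2) (hP : (p : ℤ) ≤ b 7) (hQ : b 0 < (p : ℤ) + b 3 + b 7) (hQ45 : (p : ℤ) + b 4 + b 5 ≤ b 0)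
    (hF1 : b 1 < 2 * (p : ℤ)) (hF2 : b 0 < 2 * (p : ℤ) + b 6 + b 7) (hpd : (p : ℤ) ≤ dOf b) (hcas : casoratian b j ≠ 0) : (-2 : ℤ) ≤ padicValRat p (casoratian b j) := by
  haveI : Fact p.Prime := ⟨hprime⟩
  have hp2 : p % 2 = 1 := Nat.odd_iff.1 (hprime.odd_of_ne_two (by omega))
  obtain ⟨h21, h32, h43, h54, h65, h76⟩ := sorted7_chain hs
  have hpb : (p : ℤ) ≤ b 0 := by linarith
  have hT : ([1, -3, -3, 1] : List ℤ).reverse = [1, -3, -3, 1] := by decide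
  rcases Int.emod_two_eq_zero_or_one (b 0) with hr | hr
  · exact cover_A3K hb hbj hj1 hj7 hprime hp5 hpb hwin hpd (cover6a_ev hb hs hP hQ hQ45 hF1 hF2 hp5 hp2 hr) (M := 4) (by norm_num) (by decide) hT
      (by rw [oddFlag_false hr]; decide) (by norm_num) hcas
  · exact cover_A3K hb hbj hj1 hj7 hprime hp5 hpb hwin hpd (cover6a_od hb hs hP hQ hQ45 hF1 hF2 hp5 hp2 hr) (M := 4) (by norm_num) (by decide) hT
      (by rw [oddFlag_true hr]; decide) (by norm_num) hcas

/-- On this profile `d(b) < 2p`. -/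
theorem d_lt_two6a (hs : Sorted7 b) (hP : (p : ℤ) ≤ b 7) (hQ : b 0 < (p : ℤ) + b 3 + b 7) (_hQ45 : (p : ℤ) + b 4 + b 5 ≤ b 0) : dOf b < 2 * (p : ℤ) := by
  obtain ⟨h21, h32, h43, h54, h65, h76⟩ := sorted7_chain hs
  rw [DecompositionWholeCone.dOf_expand]; linarith

/-- **`PathAccountingFirstPeriod`'s conclusion on this `N_p = 6` profile (short blocks all `(1,k)`, `(2,k)`, `(3,k)`), EVERY sorted `b`, every direction `j`, every depth**
(`C⋆ ≤ 8`; `d < 2p`; the node asks `-3` at `⌊d/p⌋ = 0` and `-2` at `⌊d/p⌋ = 1`). -/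
theorem pathAccounting_profile6a (b : ℕ → ℤ) (j p : ℕ) (hb : InPolytope b) (hs : Sorted7 b) (hbj : InPolytope (shift b j))
    (hj1 : 1 ≤ j) (hj7 : j ≤ 7) (hprime : p.Prime) (hp5 : 5 ≤ p) (hwin : (b 0 + 2 : ℤ) < (p : ℤ) ^ 2) (hfp : FirstPeriod b p)
    (hP : (p : ℤ) ≤ b 7) (hQ : b 0 < (p : ℤ) + b 3 + b 7) (hQ45 : (p : ℤ) + b 4 + b 5 ≤ b 0)
    (hcas : casoratian b j ≠ 0) :
    dOf b / (p : ℤ) - pairFloors b p - min (if 2 ≤ dOf b / (p : ℤ) then (1 : ℤ) else 0) (5 - (cStar b p : ℤ))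
      ≤ padicValRat p (casoratian b j) := by
  obtain ⟨hF1, hF2⟩ := fp_bounds hfp
  have hp0 : (0 : ℤ) < p := by exact_mod_cast hprime.pos
  rw [pairFloors_eq_6a hb hs hprime.pos hQ hQ45 hfp]
  have hC : (cStar b p : ℤ) ≤ 8 := by exact_mod_cast cStar_le_eight_6a hs hQ
  have hfd : dOf b / (p : ℤ) < 2 := by rw [Int.ediv_lt_iff_lt_mul hp0]; linarith [d_lt_two6a hs hP hQ hQ45]
  rw [if_neg (by omega)]
  have hmin : -3 ≤ min (0 : ℤ) (5 - (cStar b p : ℤ)) := le_min (by norm_num) (by linarith)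
  by_cases h1 : (p : ℤ) ≤ dOf b
  · have hfd1 : dOf b / (p : ℤ) ≤ 1 := by omega
    linarith [cas_ge6a_neg2 hb hs hbj hj1 hj7 hprime hp5 hwin hP hQ hQ45 hF1 hF2 h1 hcas]
  · push Not at h1
    have hd0 : 0 ≤ dOf b := by have := hb.2.2; unfold dOf; linarith
    have hfd0 : dOf b / (p : ℤ) = 0 := Int.ediv_eq_zero_of_lt hd0 h1
    rw [hfd0]
    linarith [cas_ge6a_neg3 hb hs hbj hj1 hj7 hprime hp5 hwin hP hQ hQ45 hF1 hF2 hcas]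

/-- **THE NODE ON THIS `N_p = 6` PROFILE, EVERY SORTED `b`, EVERY DEPTH: `PathAccountingFirstPeriod` with its binders VERBATIM plus `p ≤ b₇` and the profile
inequalities.** -/
theorem pathAccountingFirstPeriod_profile6a :
    ∀ (b : ℕ → ℤ) (p : ℕ), InPolytope b → Sorted7 b → InPolytope (shift b 7) →
      p.Prime → 5 ≤ p → (b 0 + 2 : ℤ) < (p : ℤ) ^ 2 → FirstPeriod b p →
      (p : ℤ) ≤ b 7 → b 0 < (p : ℤ) + b 3 + b 7 → (p : ℤ) + b 4 + b 5 ≤ b 0 → casoratian b 7 ≠ 0 →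
        dOf b / (p : ℤ) - pairFloors b p - min (if 2 ≤ dOf b / (p : ℤ) then (1 : ℤ) else 0) (5 - (cStar b p : ℤ))
          ≤ padicValRat p (casoratian b 7) :=
  fun b p hb hs hb7 hprime hp5 hwin hfp hP hQ hQ45 hcas =>
    pathAccounting_profile6a b 7 p hb hs hb7 (by norm_num) (by norm_num) hprime hp5 hwin hfp hP hQ hQ45 hcas

end P6A

end Summit.KontsevichZagierPeriods.Zeta5Search.FullProfile
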